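import Summits.ResolutionOfSingularities.ResolutionOfSingularities.Theorems.HilbertSamuelEliminationSigmaMaxModificationsCorridor3WLadderIsoInsepShadowCalculus
import HarnessLib

/-!
# [OURS · L1 W4.2 · k2 `T3insep`] `Corridor3WLadderIsoInsepShadowBiSection` — restriction to a COHERENT formal bi-section commutes with the
# chart: the FULLY twisted shadow of a layered ridge tail obeys the split law EXACTLY (second reader's N5⁺, PROVED)

Additive sibling of res-D-pv-042's k2 PART 1 `…Corridor3WLadderIsoInsepShadowCalculus` (p526949: `MilnorAlg`, `IsShadowChain₂`, `no_shadowChain₂`, `bl`,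
`twist_identity_lin`, `IsTwistedChain₂`), per res-L1-w42-plan-1 RULING v3.14-13 (DC) («067 = named second reader») and my SECOND-READER WORD
2026-08-27T11:09:24Z. Mathematics: res-L1-w42-idea-1 card C7 `ridge-twist-layer-calculus` (the x-twist); this file adds the y-twist and removes every
restriction on the layers / `D_λ`-motion by one observation: RESTRICTION TO THE STRICT TRANSFORM OF A FORMAL BI-SECTION `{x = σ(z,w), y = ρ(z,w)}`
COMMUTES WITH THE CHART MAP. OURS (cell res-hironaka, slot W4.2); NOT statements of H. Hironaka's manuscript [Hironaka2017] nor of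
[CossartJannsenSaito2020]; AI-typed, weaker than expert review. `--supports stmt-ResolutionOfSingularities-19249 --as helper` (counted 0).
FACT-FREE: pure power-series algebra over an arbitrary field (`κ : Type`, any characteristic until the last theorem, which is `CharP κ 2` via W4.1).

## Contents (namespace `…Cruxes.SigmaMaxModifications.IdeasL1C6`, PART 1's)

* `sec σ ρ := ![σ, ρ, X 0, X 1]` (restriction `κ⟦x,y,z,w⟧ → κ⟦z,w⟧`, `F ↦ F(σ, ρ, z, w)`), `bl4 i τ` (the chart on `κ⟦x,y,z,w⟧` at a near point on the
  directrix line: `x ↦ X·x`, `y ↦ X·y`, plane as PART 1's `bl`), `readaptBy ℓx ℓy` (`x ↦ x + ℓx`, `y ↦ y + ℓy`); `HasSubst` lemmas.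
* **`subst_sec_bl4`**: `X_iσ' = σ∘Φ ∧ X_iρ' = ρ∘Φ ⇒ (F∘Φ₄)(σ', ρ') = (F(σ, ρ))∘Φ`; **`bisection_split_law`**: `X²·F' = F∘Φ₄ ⇒ X_i²·F'(σ', ρ') = F(σ, ρ)∘Φ`
  — PART 1's split step law with junk `s = 0`; `subst_sec_readaptBy`: `F'(x + ℓx, y + ℓy)(σ, ρ) = F'(σ + ℓx, ρ + ℓy)`.
* `IsBiTwistedChain₂ F σ ρ` (stage equations + chart + linear re-adaptation of BOTH ridge variables + coherent bi-section through the origins;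
  `G_n := F_n(σ_n, ρ_n)` of order `≥ 2`, no `zw`-term, FINITE Milnor algebra = card C7's clause K2B-fin as an INPUT), `IsBiTwistedChain₂.shadow`,
  **`no_biTwistedChain₂ [CharP κ 2]`**. So at `p = 2` the k2b tail's only non-glue content is K2B-fin; the x- and y-twists and `D_λ`-moving coefficients
  (card C7 «typed so far only for ρ = 0») cost nothing.
-/

noncomputable section

set_option linter.dupNamespace false

open scoped BigOperators Classical
open MvPowerSeries
open Literature.AlgebraicGeometry.Resolution
open Summit.ResolutionOfSingularities.ResolutionOfSingularities.Theorems.WildCones.MuDropCharTwoOrdP (hasSubst_blowFam)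

namespace Summit.ResolutionOfSingularities.ResolutionOfSingularities.Cruxes.SigmaMaxModifications.IdeasL1C6

section BiSection

variable {κ : Type} [Field κ]

/-- [OURS · L1 W4.2] the formal BI-SECTION `{x = σ(z,w), y = ρ(z,w)}`: the restriction map `κ⟦x,y,z,w⟧ → κ⟦z,w⟧`, `F ↦ F(σ, ρ, z, w)`
(indices: `x,y,z,w = X 0, X 1, X 2, X 3`; plane `z,w = X 0, X 1`). NOT a statement of the manuscript. [folklore] -/
def sec (σ ρ : MvPowerSeries (Fin 2) κ) : Fin 4 → MvPowerSeries (Fin 2) κ :=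
  ![σ, ρ, X 0, X 1]

/-- [OURS · L1 W4.2] the blow-up chart on `κ⟦x,y,z,w⟧` at a near point ON the directrix line `{x̄ = ȳ = 0}`: chart of the exceptional-plane
variable `i` with translation `τ` in the plane (`bl`), and `x ↦ X·x`, `y ↦ X·y` (`X` the chart variable). NOT a statement of the manuscript. [folklore] -/
def bl4 (i : Fin 2) (τ : Fin 2 → κ) : Fin 4 → MvPowerSeries (Fin 4) κ :=
  ![X (Fin.natAdd 2 i) * X 0, X (Fin.natAdd 2 i) * X 1,
    rename (Fin.natAdd 2) (bl i τ 0), rename (Fin.natAdd 2) (bl i τ 1)]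

/-- [OURS · L1 W4.2] the LINEAR RE-ADAPTATION `x ↦ x + ℓx(z,w)`, `y ↦ y + ℓy(z,w)` by absorbed forms (the directrix turns; both ridge variables).
NOT a statement of the manuscript. [folklore] -/
def readaptBy (ℓx ℓy : MvPowerSeries (Fin 2) κ) : Fin 4 → MvPowerSeries (Fin 4) κ :=
  ![X 0 + rename (Fin.natAdd 2) ℓx, X 1 + rename (Fin.natAdd 2) ℓy, X 2, X 3]

/-- A bi-section through the origin is a legitimate substitution. [folklore] -/
theorem hasSubst_sec {σ ρ : MvPowerSeries (Fin 2) κ} (hσ : constantCoeff σ = 0) (hρ : constantCoeff ρ = 0) :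
    HasSubst (sec σ ρ) :=
  hasSubst_of_constantCoeff_zero fun v => by fin_cases v <;> simp [sec, hσ, hρ]

/-- The chart family has no constant terms. [folklore] -/
theorem constantCoeff_bl (i : Fin 2) (τ : Fin 2 → κ) (t : Fin 2) : constantCoeff (bl i τ t) = 0 := by
  fin_cases i <;> fin_cases t <;> simp [bl]

/-- The chart on `κ⟦x,y,z,w⟧` is a legitimate substitution. [folklore] -/
theorem hasSubst_bl4 (i : Fin 2) (τ : Fin 2 → κ) : HasSubst (bl4 i τ) :=
  hasSubst_of_constantCoeff_zero fun v => by
    fin_cases v <;> simp [bl4, constantCoeff_bl]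

/-- A re-adaptation by forms without constant term is a legitimate substitution. [folklore] -/
theorem hasSubst_readaptBy {ℓx ℓy : MvPowerSeries (Fin 2) κ} (hx : constantCoeff ℓx = 0) (hy : constantCoeff ℓy = 0) :
    HasSubst (readaptBy ℓx ℓy) :=
  hasSubst_of_constantCoeff_zero fun v => by
    fin_cases v <;> simp [readaptBy, constantCoeff_rename, hx, hy]

/-- Restriction of a renamed plane series is the identity (`sec ∘ natAdd 2 = X`). [folklore] -/
theorem subst_sec_rename {σ ρ : MvPowerSeries (Fin 2) κ} (hσ : constantCoeff σ = 0) (hρ : constantCoeff ρ = 0)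
    (h : MvPowerSeries (Fin 2) κ) : subst (sec σ ρ) (rename (Fin.natAdd 2) h) = h := by
  rw [rename_eq_subst, subst_comp_subst_apply (HasSubst.X_comp _) (hasSubst_sec hσ hρ)]
  have : (fun t : Fin 2 => subst (sec σ ρ) (((X : Fin 4 → MvPowerSeries (Fin 4) κ) ∘ Fin.natAdd 2) t)) =
      (X : Fin 2 → MvPowerSeries (Fin 2) κ) := by
    funext t
    rw [Function.comp_apply, subst_X (hasSubst_sec hσ hρ)]
    fin_cases t <;> rfl
  rw [this, subst_self]; rfl

/-- Restriction of the chart variable is the plane chart variable. [folklore] -/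
theorem subst_sec_X_natAdd {σ ρ : MvPowerSeries (Fin 2) κ} (hσ : constantCoeff σ = 0) (hρ : constantCoeff ρ = 0) (i : Fin 2) :
    subst (sec σ ρ) (X (Fin.natAdd 2 i) : MvPowerSeries (Fin 4) κ) = X i := by
  rw [subst_X (hasSubst_sec hσ hρ)]; fin_cases i <;> rfl

/-- [OURS · PROVED] **RESTRICTION TO A COHERENT BI-SECTION COMMUTES WITH THE CHART**: if `X_i σ' = σ∘Φ` and `X_i ρ' = ρ∘Φ` (the
bi-section `(σ', ρ')` is the strict transform of `(σ, ρ)`), then `(F∘Φ₄)(σ', ρ') = (F(σ, ρ))∘Φ`. [folklore] -/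
theorem subst_sec_bl4 {i : Fin 2} {τ : Fin 2 → κ} {σ ρ σ' ρ' : MvPowerSeries (Fin 2) κ}
    (hσ0 : constantCoeff σ = 0) (hρ0 : constantCoeff ρ = 0) (hσ0' : constantCoeff σ' = 0) (hρ0' : constantCoeff ρ' = 0)
    (hσ : X i * σ' = subst (bl i τ) σ) (hρ : X i * ρ' = subst (bl i τ) ρ) (F : MvPowerSeries (Fin 4) κ) :
    subst (sec σ' ρ') (subst (bl4 i τ) F) = subst (bl i τ) (subst (sec σ ρ) F) := by
  rw [subst_comp_subst_apply (hasSubst_bl4 i τ) (hasSubst_sec hσ0' hρ0'),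
    subst_comp_subst_apply (hasSubst_sec hσ0 hρ0) (hasSubst_blowFam i τ)]
  congr 1
  funext v
  have hS' := hasSubst_sec hσ0' hρ0'
  have hB := hasSubst_blowFam i τ
  have hZ := subst_sec_X_natAdd hσ0' hρ0' i
  fin_cases v
  · show subst (sec σ' ρ') (X (Fin.natAdd 2 i) * X 0) = subst (bl i τ) σ
    rw [subst_mul hS', hZ, subst_X hS', ← hσ]; rfl
  · show subst (sec σ' ρ') (X (Fin.natAdd 2 i) * X 1) = subst (bl i τ) ρ
    rw [subst_mul hS', hZ, subst_X hS', ← hρ]; rfl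
  · show subst (sec σ' ρ') (rename (Fin.natAdd 2) (bl i τ 0)) = subst (bl i τ) (X 0)
    rw [subst_sec_rename hσ0' hρ0', subst_X hB]
  · show subst (sec σ' ρ') (rename (Fin.natAdd 2) (bl i τ 1)) = subst (bl i τ) (X 1)
    rw [subst_sec_rename hσ0' hρ0', subst_X hB]

/-- [OURS · PROVED] **THE BI-TWISTED SPLIT LAW**: if `X² · F' = F∘Φ₄` (chart transform) and `(σ', ρ')` is the coherent transform of `(σ, ρ)`,
then `G := F(σ, ρ)`, `G' := F'(σ', ρ')` obey §1's split step law EXACTLY, `X_i² · G' = G∘Φ` — no junk, no restriction on the layers or on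
`D_λ`-motion of the coefficients. [folklore] -/
theorem bisection_split_law {i : Fin 2} {τ : Fin 2 → κ} {σ ρ σ' ρ' : MvPowerSeries (Fin 2) κ} {F F' : MvPowerSeries (Fin 4) κ}
    (hσ0 : constantCoeff σ = 0) (hρ0 : constantCoeff ρ = 0) (hσ0' : constantCoeff σ' = 0) (hρ0' : constantCoeff ρ' = 0)
    (hσ : X i * σ' = subst (bl i τ) σ) (hρ : X i * ρ' = subst (bl i τ) ρ)
    (hF : X (Fin.natAdd 2 i) ^ 2 * F' = subst (bl4 i τ) F) :
    X i ^ 2 * subst (sec σ' ρ') F' = subst (bl i τ) (subst (sec σ ρ) F) := by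
  have hS' := hasSubst_sec hσ0' hρ0'
  rw [← subst_sec_bl4 hσ0 hρ0 hσ0' hρ0' hσ hρ F, ← hF, subst_mul hS', subst_pow hS', subst_sec_X_natAdd hσ0' hρ0']

/-- [OURS · PROVED] **RE-ADAPTATION MOVES THE BI-SECTION, NOT THE RESTRICTION**: `F'(x + ℓx, y + ℓy, z, w)` restricted to `(σ, ρ)` is `F'`
restricted to `(σ + ℓx, ρ + ℓy)`. [folklore] -/
theorem subst_sec_readaptBy {σ ρ ℓx ℓy : MvPowerSeries (Fin 2) κ} (hσ : constantCoeff σ = 0) (hρ : constantCoeff ρ = 0)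
    (hx : constantCoeff ℓx = 0) (hy : constantCoeff ℓy = 0) (F' : MvPowerSeries (Fin 4) κ) :
    subst (sec σ ρ) (subst (readaptBy ℓx ℓy) F') = subst (sec (σ + ℓx) (ρ + ℓy)) F' := by
  have hS := hasSubst_sec hσ hρ
  rw [subst_comp_subst_apply (hasSubst_readaptBy hx hy) hS]
  congr 1
  funext v
  fin_cases v
  · show subst (sec σ ρ) (X 0 + rename (Fin.natAdd 2) ℓx) = σ + ℓx
    rw [subst_add hS, subst_X hS, subst_sec_rename hσ hρ]; rfl
  · show subst (sec σ ρ) (X 1 + rename (Fin.natAdd 2) ℓy) = ρ + ℓy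
    rw [subst_add hS, subst_X hS, subst_sec_rename hσ hρ]; rfl
  · show subst (sec σ ρ) (X 2) = X 0
    rw [subst_X hS]; rfl
  · show subst (sec σ ρ) (X 3) = X 1
    rw [subst_X hS]; rfl

/-- [OURS · L1 W4.2 · C7 generalised] a **BI-TWISTED RIDGE CHAIN** at `p = 2`: stage equations `F_n ∈ κ⟦x,y,z,w⟧` (ridge-presented tails, layers and
all), each step = chart transform `X²·F♯ = F_n∘Φ₄` followed by a linear re-adaptation `F_{n+1} = F♯(x + ℓx, y + ℓy, z, w)`, a COHERENT bi-section
(`X_i(σ_{n+1} + ℓx) = σ_n∘Φ`, `X_i(ρ_{n+1} + ℓy) = ρ_n∘Φ`) through the origins, and the restricted series `G_n = F_n(σ_n, ρ_n)` of order `≥ 2`,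
without `zw`-term, with FINITE Milnor algebras (the K2B-fin INPUT). NOT a statement of the manuscript. [folklore] -/
structure IsBiTwistedChain₂ (F : ℕ → MvPowerSeries (Fin 4) κ) (σ ρ : ℕ → MvPowerSeries (Fin 2) κ) : Prop where
  origin : ∀ n, constantCoeff (σ n) = 0 ∧ constantCoeff (ρ n) = 0
  step : ∀ n, ∃ (i : Fin 2) (τ : Fin 2 → κ) (ℓx ℓy : MvPowerSeries (Fin 2) κ) (Fs : MvPowerSeries (Fin 4) κ),
    constantCoeff ℓx = 0 ∧ constantCoeff ℓy = 0 ∧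
    X (Fin.natAdd 2 i) ^ 2 * Fs = subst (bl4 i τ) (F n) ∧ F (n + 1) = subst (readaptBy ℓx ℓy) Fs ∧
    X i * (σ (n + 1) + ℓx) = subst (bl i τ) (σ n) ∧ X i * (ρ (n + 1) + ℓy) = subst (bl i τ) (ρ n)
  two_le : ∀ n, 2 ≤ (subst (sec (σ n) (ρ n)) (F n)).order
  nopair : ∀ n, coeff (Finsupp.single 0 1 + Finsupp.single 1 1) (subst (sec (σ n) (ρ n)) (F n)) = 0
  finite : ∀ n, Module.Finite κ (MilnorAlg (subst (sec (σ n) (ρ n)) (F n)))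

/-- [OURS · PROVED] the restricted series of a bi-twisted ridge chain form a §1 SHADOW CHAIN (junk `s = 0`). [folklore] -/
theorem IsBiTwistedChain₂.shadow {F : ℕ → MvPowerSeries (Fin 4) κ} {σ ρ : ℕ → MvPowerSeries (Fin 2) κ} (h : IsBiTwistedChain₂ F σ ρ) :
    IsShadowChain₂ (fun n => subst (sec (σ n) (ρ n)) (F n)) where
  two_le := h.two_le
  nopair := h.nopair
  finite := h.finite
  step n := by
    obtain ⟨i, τ, ℓx, ℓy, Fs, hx, hy, hFs, hF, hσ, hρ⟩ := h.step n
    obtain ⟨hσ0, hρ0⟩ := h.origin n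
    obtain ⟨hσ1, hρ1⟩ := h.origin (n + 1)
    have hσ1' : constantCoeff (σ (n + 1) + ℓx) = 0 := by rw [map_add, hσ1, hx, add_zero]
    have hρ1' : constantCoeff (ρ (n + 1) + ℓy) = 0 := by rw [map_add, hρ1, hy, add_zero]
    refine ⟨i, τ, 0, fun _ => map_zero _, ?_⟩
    rw [sub_zero]
    show X i ^ 2 * subst (sec (σ (n + 1)) (ρ (n + 1))) (F (n + 1)) = subst (bl i τ) (subst (sec (σ n) (ρ n)) (F n))
    rw [hF, subst_sec_readaptBy hσ1 hρ1 hx hy]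
    exact bisection_split_law hσ0 hρ0 hσ1' hρ1' hσ hρ hFs

/-- [OURS · PROVED from W4.1] **NO INFINITE BI-TWISTED RIDGE CHAIN** in characteristic 2: given K2B-fin (the `finite` field), W4.1's surface drop
kills every such chain — the x-twist, the y-twist and the `D_λ`-motion of the coefficients are all absorbed by the bi-section. [folklore] -/
theorem no_biTwistedChain₂ [CharP κ 2] (F : ℕ → MvPowerSeries (Fin 4) κ) (σ ρ : ℕ → MvPowerSeries (Fin 2) κ)
    (h : IsBiTwistedChain₂ F σ ρ) : False :=
  no_shadowChain₂ _ h.shadow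

end BiSection

end Summit.ResolutionOfSingularities.ResolutionOfSingularities.Cruxes.SigmaMaxModifications.IdeasL1C6

end
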